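import Summits.CriticalPhenomena.PercolationContinuityZ3.Theorems.PercNearOneGluingNoHeavyLowerTailLossyPocketTransfer
import Summits.CriticalPhenomena.PercolationContinuityZ3.Theorems.PercNearOneGluingNoHeavyLowerTailSignedStarTransfer
import HarnessLib

/-!
# `NoHeavyLowerTail` (stmt-CriticalPhenomena-4575) — the SIGNED GLUED-BLOCK TRANSFER (full-cluster form)

Support file (engine seat `prim-cplus-engine` g5; `--supports stmt-CriticalPhenomena-4575`).  No definitions, no
named facts, no sorries.

`LossyPocketT.blockSmall_le_gluedSmall_add` (g2) compares the probability that a GLUED relay block `N ∋ v` is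
`j`-small with the probability that a fixed relay `c` is `j`-small in `G + K_N`, at the additive price
`(μ{v small} − μ{c small})⁺`.  Run with the signed Lemma 3(ii) of `…SignedStarTransfer` (`SignedStar.lemma3_ii_signed`)
instead of the one-sided one, the same set algebra gives the SIGNED, RATIO-WEIGHTED form:

* `LossyPocketT.blockSmall_signed` — for any weights, block `N ∋ v` and vertex `c`,
  `μ{c ↮ v} · (μ{block N j-small} − μ{c j-small in G + K_N}) ≤ (μ{v small} − μ{c small}) · μ{c ↮ N}`.
  So per pocket state the defect of the single-witness cover is at most `(Φ(v) − Φ(c))·μ(c ↮ N)/μ(c ↮ v)`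
  (a factor `≤ 1` sharper than the Kozma–Nitzan slack, and a GAIN when `c` is the more fragile).  This is the
  transfer inequality behind the signed quantitative cover `LLQ` of the engine memo `ENGINE-g5.md` §3 (within
  `1.5 × bad` on every family that refuted the additive covers).
-/

noncomputable section

namespace Summit.CriticalPhenomena.PercolationContinuityZ3.Theorems

open MeasureTheory Set Literature.Probability.LatticeModels Literature.Probability.Percolation
open Literature.Probability.Percolation.KNPreFKG
open scoped Classical BigOperators

namespace LossyPocketT

variable {n : ℕ}

/-- **Signed glued-block transfer, full-cluster form.**  For any weights, a block `N ∋ v` and a vertex `c`: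
`μ{c ↮ v}·(μ{glued block N is j-small} − μ{c is j-small in G + K_N}) ≤ (μ{|π(v)| ≤ j} − μ{|π(c)| ≤ j})·μ{c ↮ N}`.
Proof: `SignedStar.lemma3_ii_signed` for the monotone cluster property `|C ∩ A| ≥ j+1` with `Q = {c ↮ N}` (so
`D ∩ Q = Q` as `v ∈ N`), then `C(v) ⊆ block` on `{c ↮ N}` and the set algebra of `blockSmall_le_gluedSmall_add`.
[cite: KozmaNitzan2024, Lemma 3(ii) (pp. 6–7), Lemma 5 (p. 13); VandenbergHaggstromKahn2005, Thms. 1.3, 1.5] -/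
theorem blockSmall_signed (w : Sym2 (Fin n) → unitInterval) (A N : Finset (Fin n))
    (c v : Fin n) (j : ℕ) (hv : v ∈ N) :
    (prodBernoulli w).real {ω : BondConfig (Fin n) | ¬ (openGraph ω).Reachable c v} *
        ((prodBernoulli w).real {ω : BondConfig (Fin n) |
            (A.filter fun y => ∃ a ∈ N, ω ∈ openConn a y).card ≤ j} -
          (prodBernoulli w).real {ω : BondConfig (Fin n) |
            ((∃ a ∈ N, ω ∈ openConn c a) ∧ (A.filter fun y => ∃ a ∈ N, ω ∈ openConn a y).card ≤ j) ∨
              ((¬ ∃ a ∈ N, ω ∈ openConn c a) ∧ (A.filter fun y => ω ∈ openConn c y).card ≤ j)}) ≤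
      ((prodBernoulli w).real {ω : BondConfig (Fin n) | (A.filter fun y => ω ∈ openConn v y).card ≤ j} -
          (prodBernoulli w).real {ω : BondConfig (Fin n) | (A.filter fun y => ω ∈ openConn c y).card ≤ j}) *
        (prodBernoulli w).real {ω : BondConfig (Fin n) | ∀ u ∈ (↑N : Set (Fin n)), ¬ (openGraph ω).Reachable c u} := by
  classical
  set μ := prodBernoulli w with hμ
  -- the monotone cluster property `|C ∩ A| ≥ j+1`
  set P : Set (Fin n) → Prop := fun S => j + 1 ≤ (A.filter fun x => x ∈ S).card with hP
  have hPmono : ∀ S T : Set (Fin n), S ⊆ T → P S → P T := by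
    intro S T hST hS
    refine le_trans hS (Finset.card_le_card fun x hx => ?_)
    simp only [Finset.mem_filter] at hx ⊢
    exact ⟨hx.1, hST hx.2⟩
  have card_openCluster : ∀ (ω : BondConfig (Fin n)) (a : Fin n),
      (A.filter fun x => x ∈ openCluster ω a).card = (A.filter fun x => ω ∈ openConn a x).card := by
    intro ω a
    have h : (A.filter fun x => x ∈ openCluster ω a) = (A.filter fun x => ω ∈ openConn a x) :=
      Finset.filter_congr fun x _ => Iff.rfl
    rw [h]
  -- events
  set Sv : Set (BondConfig (Fin n)) := {ω | (A.filter fun y => ω ∈ openConn v y).card ≤ j} with hSv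
  set Sc : Set (BondConfig (Fin n)) := {ω | (A.filter fun y => ω ∈ openConn c y).card ≤ j} with hSc
  set Sb : Set (BondConfig (Fin n)) := {ω | (A.filter fun y => ∃ a ∈ N, ω ∈ openConn a y).card ≤ j} with hSb
  set T : Set (BondConfig (Fin n)) := {ω | ∃ a ∈ N, ω ∈ openConn c a} with hT
  set Sg : Set (BondConfig (Fin n)) := {ω |
      ((∃ a ∈ N, ω ∈ openConn c a) ∧ (A.filter fun y => ∃ a ∈ N, ω ∈ openConn a y).card ≤ j) ∨
        ((¬ ∃ a ∈ N, ω ∈ openConn c a) ∧ (A.filter fun y => ω ∈ openConn c y).card ≤ j)} with hSg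
  set D : Set (BondConfig (Fin n)) := {ω | ¬ (openGraph ω).Reachable c v} with hD
  set Q : Set (BondConfig (Fin n)) := {ω | ∀ u ∈ (↑N : Set (Fin n)), ¬ (openGraph ω).Reachable c u} with hQ
  have hXc : {ω : BondConfig (Fin n) | P (openCluster ω c)} = Scᶜ := by
    ext ω; simp only [hP, hSc, mem_setOf_eq, mem_compl_iff, not_le, card_openCluster]; omega
  have hXv : {ω : BondConfig (Fin n) | P (openCluster ω v)} = Svᶜ := by
    ext ω; simp only [hP, hSv, mem_setOf_eq, mem_compl_iff, not_le, card_openCluster]; omega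
  -- `Q ⊆ D` as `v ∈ N`
  have hDQ : D ∩ Q = Q := inter_eq_right.2 fun ω hω => hω v (Finset.mem_coe.2 hv)
  -- the signed Lemma 3(ii) with `Q = {c ↮ N}`
  have L3 : μ.real D * (μ.real (Scᶜ ∩ Q) - μ.real (Svᶜ ∩ Q)) ≤ (μ.real Scᶜ - μ.real Svᶜ) * μ.real Q := by
    have key := SignedStar.lemma3_ii_signed w c v P hPmono (isLowerSet_disconnFamily c (↑N : Set (Fin n)))
    rw [← setOf_forall_not_reachable_eq, hXc, hXv] at key
    have hDQ' : {ω : BondConfig (Fin n) | ¬ (openGraph ω).Reachable c v} ∩ Q = Q := hDQ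
    rw [hDQ'] at key
    exact key
  -- `{c ↮ N} = Tᶜ`
  have hTc : Q = Tᶜ := by
    ext ω
    simp only [hQ, hT, mem_setOf_eq, mem_compl_iff, not_exists, not_and, Finset.mem_coe]
    rfl
  -- `C(v) big ⇒ block big`
  have hvb : Svᶜ ⊆ Sbᶜ := by
    intro ω hω
    simp only [hSv, hSb, mem_compl_iff, mem_setOf_eq, not_le] at hω ⊢
    refine lt_of_lt_of_le hω (Finset.card_le_card fun y hy => ?_)
    simp only [Finset.mem_filter] at hy ⊢
    exact ⟨hy.1, v, hv, hy.2⟩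
  -- `Sgᶜ ⊆ (T ∩ Sbᶜ) ∪ (Scᶜ ∩ Tᶜ)`
  have hSgsub : Sgᶜ ⊆ (T ∩ Sbᶜ) ∪ (Scᶜ ∩ Tᶜ) := by
    intro ω hω
    simp only [hSg, hT, hSb, hSc, mem_compl_iff, mem_setOf_eq, mem_union, mem_inter_iff, not_or, not_and,
      not_le] at hω ⊢
    by_cases hcT : ∃ a ∈ N, ω ∈ openConn c a
    · exact Or.inl ⟨hcT, hω.1 hcT⟩
    · exact Or.inr ⟨hω.2 hcT, hcT⟩
  have e1 : μ.real (Sbᶜ ∩ T) + μ.real (Sbᶜ \ T) = μ.real Sbᶜ :=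
    measureReal_inter_add_sdiff (MeasurableSet.of_discrete : MeasurableSet T) (measure_ne_top _ _)
  have hU : μ.real Sgᶜ ≤ μ.real (T ∩ Sbᶜ) + μ.real (Scᶜ ∩ Tᶜ) :=
    (measureReal_mono hSgsub).trans (measureReal_union_le _ _)
  have hvbT : μ.real (Svᶜ ∩ Tᶜ) ≤ μ.real (Sbᶜ ∩ Tᶜ) :=
    measureReal_mono fun ω ⟨h1, h2⟩ => ⟨hvb h1, h2⟩
  have hD0 : 0 ≤ μ.real D := measureReal_nonneg
  rw [hTc] at L3
  -- complements to probabilities of the `small` events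
  have cSg : μ.real Sgᶜ = 1 - μ.real Sg := probReal_compl_eq_one_sub MeasurableSet.of_discrete
  have cSb : μ.real Sbᶜ = 1 - μ.real Sb := probReal_compl_eq_one_sub MeasurableSet.of_discrete
  have cSc : μ.real Scᶜ = 1 - μ.real Sc := probReal_compl_eq_one_sub MeasurableSet.of_discrete
  have cSv : μ.real Svᶜ = 1 - μ.real Sv := probReal_compl_eq_one_sub MeasurableSet.of_discrete
  have s4 : μ.real (T ∩ Sbᶜ) + μ.real (Sbᶜ ∩ Tᶜ) = μ.real Sbᶜ := by
    rw [inter_comm T Sbᶜ, ← Set.sdiff_eq, e1]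
  have s1 : μ.real D * μ.real Sgᶜ ≤ μ.real D * (μ.real (T ∩ Sbᶜ) + μ.real (Scᶜ ∩ Tᶜ)) :=
    mul_le_mul_of_nonneg_left hU hD0
  have s3 : μ.real D * μ.real (Svᶜ ∩ Tᶜ) ≤ μ.real D * μ.real (Sbᶜ ∩ Tᶜ) :=
    mul_le_mul_of_nonneg_left hvbT hD0
  have main : μ.real D * μ.real Sgᶜ ≤ μ.real D * μ.real Sbᶜ + (μ.real Scᶜ - μ.real Svᶜ) * μ.real Tᶜ := by
    rw [← s4]
    linarith [s1, L3, s3]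
  rw [cSg, cSb, cSc, cSv] at main
  rw [hTc]
  linarith [main]

end LossyPocketT

end Summit.CriticalPhenomena.PercolationContinuityZ3.Theorems

end
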